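import Literature.AlgebraicGeometry.RelativeSpec.GeometricQuotientFreeTorsor
import Literature.AlgebraicGeometry.RelativeSpec.GeometricQuotientFreeFlat
import Literature.AlgebraicGeometry.RelativeSpec.GeometricQuotientFreeEtale
import Literature.AlgebraicGeometry.Morphisms.FiniteEtaleGeometricFibreCard
import Literature.AlgebraicGeometry.Morphisms.GeometricPointsLiftSurjective
import Mathlib.FieldTheory.IsAlgClosed.AlgebraicClosure
import HarnessLib

/-!
# The quotient map of a FREE action of a finite group has degree `|G|` everywhere ([SGA1] Exp. V Prop. 2.6; [MumfordAV1970] §7 Thm. p. 66, §12)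

Topic `Literature/AlgebraicGeometry/RelativeSpec`, namespace `Literature.AlgebraicGeometry.RelativeSpec.ActionOver.IsGeometricQuotient`.  THEOREMS ONLY
(no definition, no named fact, no instance, no notation, no `sorry`).  Sequel of ★ `GeometricQuotientFreeTorsor` (on field-valued points the fibres of a
free affine geometric quotient `p : X → Q` are `G`-TORSORS: `exists_eq_comp_aut_of_comp_eq_of_free`, `eq_of_comp_aut_eq_of_free`), ★
`GeometricQuotientFreeFlat` ∕ `GeometricQuotientFreeEtale` (`p` is finite, flat, étale) and ★ `Morphisms/FiniteEtaleGeometricFibreCard` (for a finite étale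
map the number of `Ω`-points over a geometric point is the rank `Scheme.Hom.finrank`).  Cell `pub/hodgecm-mathlib` (D-0151 ∕ D-0183 floor 0), P6 «MOD
programme», sub-line P6c «DICT» organ (o-c3h) «an isogeny with prescribed constant kernel is the quotient» (the rank of `A → A⁄K` is `|K|`); generic,
count-neutral capital `--supports stmt-HodgeConjecture-24832`.  HONEST LABEL: HC_CM is proved only modulo the printed citations until rung 0 closes;
this file pays no letter.

* `natCard_specOver_eq_natCard_of_free` — for a free affine geometric quotient `p : X → Q` by the finite group `G`, `p` locally of finite type, and a
  geometric point `s : Spec Ω → Q` (`Ω` algebraically closed): `#{x : Spec Ω → X | x ≫ p = s} = |G|` (a point `x₀` over `s` exists — ★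
  `Morphisms.exists_comp_eq_of_surjective` — and `g ↦ x₀ ≫ g` is a bijection onto the fibre by the torsor property);
* **`finrank_eq_natCard_of_free`** — hence the RANK of `p` at EVERY point `q ∈ Q` is `|G|` (geometric point at `q` through the algebraic closure
  of `κ(q)`; ★ `natCard_specOver_eq_finrank` for the finite étale `p`).

## References
* [SGA1] A. Grothendieck, *SGA 1*, Exp. V, Prop. 2.6 and Déf. 2.7 (principal `G`-covers: `X × G ⥲ X ×_Y X`, degree `|G|`).
* [MumfordAV1970] D. Mumford, *Abelian Varieties* (1970), §7 Thm. p. 66 and §12 Thm. 1 (p. 112) (`X → X⁄G` finite flat of degree `|G|` for a free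
  action).
-/

noncomputable section

universe u

open CategoryTheory Limits AlgebraicGeometry

namespace Literature.AlgebraicGeometry.RelativeSpec.ActionOver.IsGeometricQuotient

variable {X Q : Scheme.{u}} {p : X ⟶ Q} {G : Type u} [Group G] {ρ : ActionOver p G} [Fintype G] [IsAffineHom p]
  (hq : ρ.IsGeometricQuotient p)
  (hfree : ∀ (V : Q.Opens), IsAffineOpen V → ∀ g : G, g ≠ 1 →
    Ideal.span (Set.range fun b : Γ(X, p ⁻¹ᵁ V) ↦ ρ.act g V b - b) = ⊤)

include hq hfree

/-- **The geometric fibres of a free quotient are `G`-torsors, counted**: for `p : X → Q` a free affine geometric quotient by the finite group `G`,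
locally of finite type, and a geometric point `s : Spec Ω → Q` with `Ω` algebraically closed, the `Ω`-points of `X` over `s` number exactly `|G|`.
[cite: SGA1, Exp. V Prop. 2.6 and Déf. 2.7] [cite: MumfordAV1970, §7 Thm. p. 66 (1)] -/
theorem natCard_specOver_eq_natCard_of_free [LocallyOfFiniteType p] {Ω : Type u} [Field Ω] [IsAlgClosed Ω]
    (s : Spec (.of Ω) ⟶ Q) : Nat.card {x : Spec (.of Ω) ⟶ X // x ≫ p = s} = Nat.card G := by
  haveI : Surjective p := ⟨hq.surjective⟩
  obtain ⟨x₀, hx₀⟩ := Literature.AlgebraicGeometry.Morphisms.exists_comp_eq_of_surjective p s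
  symm
  refine Nat.card_eq_of_bijective
    (fun g : G => (⟨x₀ ≫ (ρ.aut g).hom, by rw [Category.assoc, hq.comp_eq, hx₀]⟩ : {x : Spec (.of Ω) ⟶ X // x ≫ p = s}))
    ⟨fun g h e => ?_, fun x => ?_⟩
  · exact eq_of_comp_aut_eq_of_free hfree x₀ (congrArg Subtype.val e)
  · obtain ⟨g, hg⟩ := hq.exists_eq_comp_aut_of_comp_eq_of_free hfree x₀ x.1 (by rw [hx₀, x.2])
    exact ⟨g, Subtype.ext hg.symm⟩

/-- **THE QUOTIENT MAP OF A FREE ACTION HAS RANK `|G|` EVERYWHERE**: for `p : X → Q` a free affine geometric quotient by the finite group `G`,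
locally of finite type (finite and étale by ★ `isFinite_of_free`, `etale_of_free`), `p.finrank q = |G|` at every `q ∈ Q` — SGA 1's «`X × G ⥲
X ×_Q X`» read in degrees, via a geometric point through the algebraic closure of `κ(q)` and ★ `natCard_specOver_eq_finrank`.
[cite: SGA1, Exp. V Prop. 2.6] [cite: MumfordAV1970, §12 Thm. 1 (p. 112)] -/
theorem finrank_eq_natCard_of_free [LocallyOfFiniteType p] (q : Q) :
    p.finrank q = Nat.card G := by
  haveI := hq.flat_of_free hfree
  haveI := hq.isFinite_of_free hfree
  haveI : Etale p := hq.etale_of_free hfree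
  -- a geometric point at `q` through the algebraic closure of the residue field
  let Ω : Type u := AlgebraicClosure (Q.residueField q)
  let s : Spec (.of Ω) ⟶ Q := Spec.map (CommRingCat.ofHom (algebraMap (Q.residueField q) Ω)) ≫ Q.fromSpecResidueField q
  have hs : s.base (IsLocalRing.closedPoint Ω) = q := by
    change (Q.fromSpecResidueField q).base ((Spec.map (CommRingCat.ofHom (algebraMap (Q.residueField q) Ω))).base _) = q
    rw [Subsingleton.elim ((Spec.map (CommRingCat.ofHom (algebraMap (Q.residueField q) Ω))).base (IsLocalRing.closedPoint Ω))
      (IsLocalRing.closedPoint (Q.residueField q)), Scheme.fromSpecResidueField_apply]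
  rw [← hs, ← Literature.AlgebraicGeometry.Morphisms.natCard_specOver_eq_finrank p s]
  exact hq.natCard_specOver_eq_natCard_of_free hfree s

end Literature.AlgebraicGeometry.RelativeSpec.ActionOver.IsGeometricQuotient

end
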